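import Mathlib.Analysis.InnerProductSpace.Calculus
import Literature.Topology.FourManifolds.TorusCoordinates
import Literature.Topology.FourManifolds.SpecialLinearPath
import Literature.Topology.FourManifolds.MappingTorusGlue
import Literature.Topology.FourManifolds.SmoothEmbeddingCriteria
import HarnessLib

/-!
# The section circle of the mapping torus of `A ∈ SL(3, ℤ)` and its tubular neighbourhood

This file constructs the input of the Cappell–Shaneson surgery (Cappell–Shaneson, *Some new
four-manifolds*, Ann. of Math. 104 (1976), §2; Gompf, *More Cappell–Shaneson spheres are
standard*, Algebr. Geom. Topol. 10 (2010), §§2–3): for `A ∈ SL(3, ℤ)`,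

* the smooth mapping torus `T_A = Literature.CSTorus A` of the linear diffeomorphism
  `torusDiffeomorph A` of `T³` (the glued manifold `Literature.Topology.FourManifolds.MappingTorusGlued` of
  `Literature.Topology.FourManifolds.MappingTorusGlue`, charted on `ℝ⁴`), an open gluing of the
  cylinders `T³ × (0, 1)` and `T³ × (1/2, 3/2)` along `mappingTorusRel (torusDiffeomorph A)`;
* the *section circle* `Literature.sectionCircle A γ : 𝕊¹ → T_A` through the fixed point `1 ∈ T³`,
  a smoothly embedded circle with image `inl ({1} × (0, 1)) ∪ inr ({1} × (1/2, 3/2))`;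
* a tubular neighbourhood `Literature.sectionCircleNbhd A γ : CircleNbhd (𝓡 4) (sectionCircle A γ)`,
  i.e. an open smooth embedding `ν : 𝕊¹ × ℝ³ ↪ T_A` with `ν (u, 0) = c u`.

The normal bundle of the section circle is the mapping torus of `dA = A` acting on
`T_1 T³ = ℝ³`; a trivialisation is the same as a path from `1` to `A` in `GL(3, ℝ)`, and we use
the smooth path `γ` of `Literature.Topology.FourManifolds.SpecialLinearPath` (this is Gompf's
"straightening the corresponding linear diffeomorphism of `T³` to the identity near `0`", loc.
cit. §3). Concretely, in exponential coordinates `expT : ℝ³ → T³`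
(`Literature.Topology.FourManifolds.TorusCoordinates`) the tube is
`(s, w) ↦ (expT (γ(2s) • shrink w), s)` over the first cylinder and
`(t, w) ↦ (expT (A γ(2(t - 1)) • shrink w), t)` over the second, where `shrink : ℝ³ ≅ B(0, ε)`
and `ε` is small enough for `expT` to be injective on all the exponents; the two formulas agree
under the gluing `(x, s) ∼ (A x, s + 1)` because `torusMap A ∘ expT = expT ∘ A` and `γ ≡ 1` near
`0`, `γ ≡ A` on `[1/2, ∞)`. Smoothness and the embedding property are verified with the chart
criteria of `Literature.Topology.FourManifolds.SmoothEmbeddingCriteria` and the embedding lemmas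
for `inl`, `inr` of `Literature.Topology.FourManifolds.GluingConstruction`.

## Main definitions and results

* `Literature.Topology.FourManifolds.TubeTwist`, `Literature.TubeTwist.tube J`: a smooth family of invertible matrices with a radius,
  and the resulting partial diffeomorphism `J × ℝ³ ⇀ T³ × J`.
* `Literature.Topology.FourManifolds.angleChartA`, `Literature.Topology.FourManifolds.angleChartB`: the angle charts `𝕊¹ ∖ {(1,0)} ≅ (0, 1)`,
  `𝕊¹ ∖ {(-1,0)} ≅ (1/2, 3/2)`; `Literature.Topology.FourManifolds.TubeTwist.tubeA`, `Literature.Topology.FourManifolds.TubeTwist.tubeB`: the tubes over the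
  two cylinders parametrised by `𝕊¹ × ℝ³`.
* `Literature.twistA A γ`, `Literature.twistB A γ`: the twisting data `γ(2s)`, `A γ(2(t-1))`;
  `Literature.Topology.FourManifolds.inl_tubeA_eq_inr_tubeB`: compatibility with the gluing.
* `Literature.CSTorus A`, `Literature.secNbhdFun A γ`, `Literature.Topology.FourManifolds.isSmoothEmbedding_secNbhdFun`,
  `Literature.sectionCircle A γ`, `Literature.Topology.FourManifolds.isSmoothEmbedding_sectionCircle`, `Literature.Topology.FourManifolds.range_sectionCircle`,
  `Literature.sectionCircleNbhd A γ`.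
* `Literature.Topology.FourManifolds.exists_mappingTorus_sectionCircleNbhd_witness`: the packaged existence statement (the
  explicit form of the named fact `Literature.Topology.FourManifolds.exists_mappingTorus_sectionCircleNbhd` of
  `Literature.Topology.FourManifolds.CircleSurgeryProofs`, discharged there).

Everything in this file is proved; the tags are `[folklore]` (constructions and chart
bookkeeping) except the summary, which cites Cappell–Shaneson 1976, §2.
-/

open scoped Manifold ContDiff Topology Real
open Set Function Metric Filter

noncomputable section

namespace Literature.Topology.FourManifolds

/-- Local notation: `𝔼 n` is the model Euclidean space `EuclideanSpace ℝ (Fin n)`. -/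
local notation "𝔼 " n:arg => EuclideanSpace ℝ (Fin n)

/-- Local notation: `𝕊 n` is the unit sphere in `EuclideanSpace ℝ (Fin (n + 1))`. -/
local notation "𝕊 " n:arg => (Metric.sphere (0 : EuclideanSpace ℝ (Fin (n + 1))) 1)

/-- Local notation: the model with corners `𝓣 = (𝓡 1).prod ((𝓡 1).prod (𝓡 1))` of `ThreeTorus`. -/
local notation "𝓣" =>
  (ModelWithCorners.prod (𝓡 1) (ModelWithCorners.prod (𝓡 1) (𝓡 1)))

/-! ### Partial diffeomorphisms: composition and products -/

section PartialDiffeo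

variable {E₁ H₁ E₂ H₂ E₃ H₃ : Type*} [NormedAddCommGroup E₁] [NormedSpace ℝ E₁] [TopologicalSpace H₁]
  [NormedAddCommGroup E₂] [NormedSpace ℝ E₂] [TopologicalSpace H₂]
  [NormedAddCommGroup E₃] [NormedSpace ℝ E₃] [TopologicalSpace H₃]
  {I₁ : ModelWithCorners ℝ E₁ H₁} {I₂ : ModelWithCorners ℝ E₂ H₂} {I₃ : ModelWithCorners ℝ E₃ H₃}
  {X₁ : Type*} [TopologicalSpace X₁] [ChartedSpace H₁ X₁]
  {X₂ : Type*} [TopologicalSpace X₂] [ChartedSpace H₂ X₂]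
  {X₃ : Type*} [TopologicalSpace X₃] [ChartedSpace H₃ X₃] {n : WithTop ℕ∞}

/-- The composition of two open partial homeomorphisms which are `C^n` on their sources is `C^n`
on its source. [folklore] -/
theorem contMDiffOn_trans_of {e : OpenPartialHomeomorph X₁ X₂} {e' : OpenPartialHomeomorph X₂ X₃}
    (he : ContMDiffOn I₁ I₂ n e e.source) (he' : ContMDiffOn I₂ I₃ n e' e'.source) :
    ContMDiffOn I₁ I₃ n (e ≫ₕ e') (e ≫ₕ e').source := by
  rw [OpenPartialHomeomorph.trans_source, OpenPartialHomeomorph.coe_trans]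
  exact he'.comp (he.mono inter_subset_left) fun x hx ↦ hx.2

/-- The inverse of the composition of two open partial homeomorphisms with `C^n` inverses is
`C^n` on its target. [folklore] -/
theorem contMDiffOn_trans_symm_of {e : OpenPartialHomeomorph X₁ X₂}
    {e' : OpenPartialHomeomorph X₂ X₃} (he : ContMDiffOn I₂ I₁ n e.symm e.target)
    (he' : ContMDiffOn I₃ I₂ n e'.symm e'.target) :
    ContMDiffOn I₃ I₁ n (e ≫ₕ e').symm (e ≫ₕ e').target := by
  rw [OpenPartialHomeomorph.trans_target, OpenPartialHomeomorph.coe_trans_symm]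
  exact he.comp (he'.mono inter_subset_left) fun x hx ↦ hx.2

/-- The product of an open partial homeomorphism which is `C^n` on its source with the identity
is `C^n` on its source. [folklore] -/
theorem contMDiffOn_prod_refl_of {e : OpenPartialHomeomorph X₁ X₂}
    (he : ContMDiffOn I₁ I₂ n e e.source) :
    ContMDiffOn (I₁.prod I₃) (I₂.prod I₃) n (e.prod (OpenPartialHomeomorph.refl X₃))
      (e.prod (OpenPartialHomeomorph.refl X₃)).source := by
  rw [OpenPartialHomeomorph.prod_source, OpenPartialHomeomorph.refl_source]
  exact he.prodMap contMDiffOn_id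

/-- The inverse of the product of an open partial homeomorphism having a `C^n` inverse with the
identity is `C^n` on its target. [folklore] -/
theorem contMDiffOn_prod_refl_symm_of {e : OpenPartialHomeomorph X₁ X₂}
    (he : ContMDiffOn I₂ I₁ n e.symm e.target) :
    ContMDiffOn (I₂.prod I₃) (I₁.prod I₃) n (e.prod (OpenPartialHomeomorph.refl X₃)).symm
      (e.prod (OpenPartialHomeomorph.refl X₃)).target := by
  rw [OpenPartialHomeomorph.prod_target, OpenPartialHomeomorph.refl_target,
    OpenPartialHomeomorph.prod_symm, OpenPartialHomeomorph.refl_symm]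
  exact he.prodMap contMDiffOn_id

end PartialDiffeo

/-! ### Twisting data and the twisted exponential tube in `T³ × ℝ` -/

/-- **Twisting datum for a tube around `{1} × J ⊆ T³ × J`.** A smooth family of invertible real
`3 × 3` matrices `s ↦ mat s` (given with its smooth pointwise inverse `inv s`) and a radius
`ε > 0` such that `mat s` maps the `ε`-ball into the open cube `(-π, π)³` on which the exponential
coordinates `expT` of `T³` are injective. The tube is then
`(s, w) ↦ (expT (mat s • shrink w), s)` with `shrink : ℝ³ ≅ B(0, ε)`; in the Cappell–Shaneson
construction `mat` runs through a path from `1` to `A` (Cappell–Shaneson 1976, §2). [folklore] -/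
structure TubeTwist where
  /-- The radius of the ball into which `ℝ³` is shrunk. -/
  ε : ℝ
  /-- The radius is positive. -/
  ε_pos : 0 < ε
  /-- The matrix family. -/
  mat : ℝ → Matrix (Fin 3) (Fin 3) ℝ
  /-- The pointwise inverse family. -/
  inv : ℝ → Matrix (Fin 3) (Fin 3) ℝ
  /-- The entries of the family are smooth. -/
  contDiff_mat : ∀ i j, ContDiff ℝ ∞ fun s ↦ mat s i j
  /-- The entries of the inverse family are smooth. -/
  contDiff_inv : ∀ i j, ContDiff ℝ ∞ fun s ↦ inv s i j
  /-- `inv s` is a right inverse of `mat s`. -/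
  mat_mul_inv : ∀ s, mat s * inv s = 1
  /-- `inv s` is a left inverse of `mat s`. -/
  inv_mul_mat : ∀ s, inv s * mat s = 1
  /-- `mat s` maps the `ε`-ball into the cube `(-π, π)³`. -/
  abs_lt_pi : ∀ s (v : EuclideanSpace ℝ (Fin 3)), ‖v‖ < ε → ∀ i, |mulVecE (mat s) v i| < π

namespace TubeTwist

variable (D : TubeTwist)

/-- The shrinking diffeomorphism `ℝ³ ≅ B(0, ε)` (Mathlib's `univBall`). [folklore] -/
def shrink : OpenPartialHomeomorph (𝔼 3) (𝔼 3) := OpenPartialHomeomorph.univBall (0 : 𝔼 3) D.ε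

/-- The shrinking map is defined everywhere. [folklore] -/
@[simp] theorem shrink_source : D.shrink.source = univ :=
  OpenPartialHomeomorph.univBall_source _ _

/-- The shrinking map is onto the `ε`-ball. [folklore] -/
@[simp] theorem shrink_target : D.shrink.target = ball 0 D.ε :=
  OpenPartialHomeomorph.univBall_target _ D.ε_pos

/-- The shrinking map takes values in the `ε`-ball. [folklore] -/
theorem shrink_mem_ball (w : 𝔼 3) : D.shrink w ∈ ball (0 : 𝔼 3) D.ε := by
  rw [← shrink_target]; exact D.shrink.map_source (by simp)

/-- The shrinking map takes values of norm `< ε`. [folklore] -/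
theorem norm_shrink_lt (w : 𝔼 3) : ‖D.shrink w‖ < D.ε :=
  mem_ball_zero_iff.1 (D.shrink_mem_ball w)

/-- The shrinking map fixes the origin. [folklore] -/
@[simp] theorem shrink_zero : D.shrink 0 = 0 := OpenPartialHomeomorph.univBall_apply_zero _ _

/-- `shrink.symm ∘ shrink = id`. [folklore] -/
@[simp] theorem shrink_symm_apply_apply (w : 𝔼 3) : D.shrink.symm (D.shrink w) = w :=
  D.shrink.left_inv (by simp)

/-- `shrink ∘ shrink.symm = id` on the ball. [folklore] -/
theorem shrink_apply_symm_apply {v : 𝔼 3} (hv : v ∈ ball (0 : 𝔼 3) D.ε) :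
    D.shrink (D.shrink.symm v) = v :=
  D.shrink.right_inv (by rwa [shrink_target])

/-- The shrinking map is smooth. [folklore] -/
theorem contDiff_shrink : ContDiff ℝ ∞ D.shrink := OpenPartialHomeomorph.contDiff_univBall

/-- The inverse of the shrinking map is smooth on the ball. [folklore] -/
theorem contDiffOn_shrink_symm : ContDiffOn ℝ ∞ D.shrink.symm (ball (0 : 𝔼 3) D.ε) :=
  OpenPartialHomeomorph.contDiffOn_univBall_symm

/-- `inv s • (mat s • v) = v`. [folklore] -/
@[simp] theorem inv_mat_apply (s : ℝ) (v : 𝔼 3) : mulVecE (D.inv s) (mulVecE (D.mat s) v) = v := by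
  rw [mulVecE_mulVecE, D.inv_mul_mat, mulVecE_one]

/-- `mat s • (inv s • v) = v`. [folklore] -/
@[simp] theorem mat_inv_apply (s : ℝ) (v : 𝔼 3) : mulVecE (D.mat s) (mulVecE (D.inv s) v) = v := by
  rw [mulVecE_mulVecE, D.mat_mul_inv, mulVecE_one]

/-- **The twisted exponential** `texp s w = expT (mat s • shrink w) ∈ T³`. [folklore] -/
def texp (s : ℝ) (w : 𝔼 3) : ThreeTorus := expT (mulVecE (D.mat s) (D.shrink w))

/-- **The twisted logarithm** `tlog s x = shrink⁻¹ (inv s • logT x)`, inverse to `texp s` on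
`tlogDom s`. [folklore] -/
def tlog (s : ℝ) (x : ThreeTorus) : 𝔼 3 := D.shrink.symm (mulVecE (D.inv s) (logT x))

/-- The domain of the twisted logarithm at level `s`: points of `torusSlit` whose untwisted
logarithm lies in the `ε`-ball. [folklore] -/
def tlogDom (s : ℝ) : Set ThreeTorus :=
  {x | x ∈ torusSlit ∧ mulVecE (D.inv s) (logT x) ∈ ball (0 : 𝔼 3) D.ε}

/-- The exponent of `texp s w` has coordinates in `(-π, π)`. [folklore] -/
theorem abs_mat_shrink_lt (s : ℝ) (w : 𝔼 3) (i : Fin 3) :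
    |mulVecE (D.mat s) (D.shrink w) i| < π :=
  D.abs_lt_pi s _ (D.norm_shrink_lt w) i

/-- `logT (texp s w) = mat s • shrink w`. [folklore] -/
theorem logT_texp (s : ℝ) (w : 𝔼 3) : logT (D.texp s w) = mulVecE (D.mat s) (D.shrink w) :=
  logT_expT_of_abs_lt (D.abs_mat_shrink_lt s w)

/-- `texp s w ∈ torusSlit`. [folklore] -/
theorem texp_mem_torusSlit (s : ℝ) (w : 𝔼 3) : D.texp s w ∈ torusSlit :=
  expT_mem_torusSlit (D.abs_mat_shrink_lt s w)

/-- `texp s w` lies in the domain of `tlog s`. [folklore] -/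
theorem texp_mem_tlogDom (s : ℝ) (w : 𝔼 3) : D.texp s w ∈ D.tlogDom s := by
  refine ⟨D.texp_mem_torusSlit s w, ?_⟩
  rw [logT_texp, inv_mat_apply]
  exact D.shrink_mem_ball w

/-- `tlog s (texp s w) = w`. [folklore] -/
@[simp] theorem tlog_texp (s : ℝ) (w : 𝔼 3) : D.tlog s (D.texp s w) = w := by
  rw [tlog, logT_texp, inv_mat_apply, shrink_symm_apply_apply]

/-- `texp s (tlog s x) = x` on `tlogDom s`. [folklore] -/
theorem texp_tlog {s : ℝ} {x : ThreeTorus} (hx : x ∈ D.tlogDom s) : D.texp s (D.tlog s x) = x := by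
  rw [texp, tlog, D.shrink_apply_symm_apply hx.2, mat_inv_apply, expT_logT]

/-- `texp s 0 = 1`: the zero section of the tube is `{1} × J`. [folklore] -/
@[simp] theorem texp_zero (s : ℝ) : D.texp s 0 = 1 := by
  rw [texp, shrink_zero, mulVecE_zero, expT_zero]

/-- The exponent `(s, w) ↦ mat s • shrink w` is smooth. [folklore] -/
theorem contDiff_mat_shrink : ContDiff ℝ ∞ fun p : ℝ × 𝔼 3 ↦ mulVecE (D.mat p.1) (D.shrink p.2) :=
  (contDiff_mulVecE D.contDiff_mat).comp (contDiff_fst.prodMk (D.contDiff_shrink.comp contDiff_snd))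

/-- **The twisted exponential is smooth** in `(s, w)`. [folklore] -/
theorem contMDiff_texp : ContMDiff (𝓘(ℝ, ℝ).prod 𝓘(ℝ, 𝔼 3)) 𝓣 ∞ fun p : ℝ × 𝔼 3 ↦ D.texp p.1 p.2 := by
  have h : ContMDiff (𝓘(ℝ, ℝ).prod 𝓘(ℝ, 𝔼 3)) 𝓘(ℝ, 𝔼 3) ∞
      fun p : ℝ × 𝔼 3 ↦ mulVecE (D.mat p.1) (D.shrink p.2) :=
    D.contDiff_mat_shrink.comp_contMDiff (contMDiff_fst.prodMk_space contMDiff_snd)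
  exact contMDiff_expT.comp h

/-- The twisted exponential is continuous in `(s, w)`. [folklore] -/
theorem continuous_texp : Continuous fun p : ℝ × 𝔼 3 ↦ D.texp p.1 p.2 := D.contMDiff_texp.continuous

/-- The untwisted logarithm `(x, s) ↦ inv s • logT x` is smooth on `torusSlit × ℝ`. [folklore] -/
theorem contMDiffOn_inv_logT : ContMDiffOn (ModelWithCorners.prod 𝓣 𝓘(ℝ, ℝ)) 𝓘(ℝ, 𝔼 3) ∞
    (fun q : ThreeTorus × ℝ ↦ mulVecE (D.inv q.2) (logT q.1)) {q | q.1 ∈ torusSlit} := by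
  have h1 : ContMDiffOn (ModelWithCorners.prod 𝓣 𝓘(ℝ, ℝ)) 𝓘(ℝ, ℝ × 𝔼 3) ∞
      (fun q : ThreeTorus × ℝ ↦ (q.2, logT q.1)) {q | q.1 ∈ torusSlit} :=
    contMDiffOn_snd.prodMk_space (contMDiffOn_logT.comp contMDiffOn_fst fun q hq ↦ hq)
  have h2 : ContMDiff 𝓘(ℝ, ℝ × 𝔼 3) 𝓘(ℝ, 𝔼 3) ∞ fun p : ℝ × 𝔼 3 ↦ mulVecE (D.inv p.1) p.2 :=
    (contDiff_mulVecE D.contDiff_inv).contMDiff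
  exact h2.comp_contMDiffOn h1

/-- The domain `{(x, s) | x ∈ tlogDom s}` of the twisted logarithm is open in `T³ × ℝ`. [folklore] -/
theorem isOpen_tlogDom : IsOpen {q : ThreeTorus × ℝ | q.1 ∈ D.tlogDom q.2} := by
  have h : {q : ThreeTorus × ℝ | q.1 ∈ D.tlogDom q.2} =
      {q : ThreeTorus × ℝ | q.1 ∈ torusSlit} ∩
        (fun q : ThreeTorus × ℝ ↦ mulVecE (D.inv q.2) (logT q.1)) ⁻¹' ball 0 D.ε := by
    ext q; simp [tlogDom]
  rw [h]
  exact D.contMDiffOn_inv_logT.continuousOn.isOpen_inter_preimage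
    (isOpen_torusSlit.preimage continuous_fst) isOpen_ball

/-- **The twisted logarithm is smooth** on its domain. [folklore] -/
theorem contMDiffOn_tlog : ContMDiffOn (ModelWithCorners.prod 𝓣 𝓘(ℝ, ℝ)) 𝓘(ℝ, 𝔼 3) ∞
    (fun q : ThreeTorus × ℝ ↦ D.tlog q.2 q.1) {q | q.1 ∈ D.tlogDom q.2} := by
  have h : ContMDiffOn 𝓘(ℝ, 𝔼 3) 𝓘(ℝ, 𝔼 3) ∞ D.shrink.symm (ball 0 D.ε) :=
    contMDiffOn_iff_contDiffOn.2 D.contDiffOn_shrink_symm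
  exact h.comp (D.contMDiffOn_inv_logT.mono fun q hq ↦ hq.1) fun q hq ↦ hq.2

/-! ### The tube in a piece `T³ × J` -/

variable (J : TopologicalSpace.Opens ℝ)

/-- **The twisted tube in the piece `T³ × J`**, an open partial homeomorphism
`J × ℝ³ ⇀ T³ × J`, `(s, w) ↦ (texp s w, s)`, defined everywhere, with inverse
`(x, s) ↦ (s, tlog s x)` on `{(x, s) | x ∈ tlogDom s}`. [folklore] -/
def tube : OpenPartialHomeomorph (J × 𝔼 3) (ThreeTorus × J) where
  toFun p := (D.texp p.1 p.2, p.1)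
  invFun q := (q.2, D.tlog q.2 q.1)
  source := univ
  target := {q | q.1 ∈ D.tlogDom q.2}
  map_source' p _ := D.texp_mem_tlogDom p.1 p.2
  map_target' _ _ := mem_univ _
  left_inv' p _ := by simp
  right_inv' q hq := Prod.ext (D.texp_tlog hq) rfl
  open_source := isOpen_univ
  open_target :=
    D.isOpen_tlogDom.preimage (f := fun q : ThreeTorus × J ↦ (q.1, (q.2 : ℝ))) (by fun_prop)
  continuousOn_toFun :=
    ((D.continuous_texp.comp (by fun_prop : Continuous fun p : J × 𝔼 3 ↦ ((p.1 : ℝ), p.2))).prodMk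
      continuous_fst).continuousOn
  continuousOn_invFun := by
    refine continuousOn_snd.prodMk ?_
    exact D.contMDiffOn_tlog.continuousOn.comp
      (by fun_prop : Continuous fun q : ThreeTorus × J ↦ (q.1, (q.2 : ℝ))).continuousOn
      fun q hq ↦ hq

/-- The tube is defined on all of `J × ℝ³`. [folklore] -/
@[simp] theorem tube_source : (D.tube J).source = univ := rfl

/-- The target of the tube. [folklore] -/
theorem tube_target : (D.tube J).target = {q | q.1 ∈ D.tlogDom q.2} := rfl

/-- The formula for the tube. [folklore] -/
@[simp] theorem tube_apply (p : J × 𝔼 3) : D.tube J p = (D.texp p.1 p.2, p.1) := rfl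

/-- The formula for the inverse of the tube. [folklore] -/
theorem tube_symm_apply (q : ThreeTorus × J) : (D.tube J).symm q = (q.2, D.tlog q.2 q.1) := rfl

/-- **The tube is smooth.** [folklore] -/
theorem contMDiff_tube : ContMDiff (𝓘(ℝ, ℝ).prod 𝓘(ℝ, 𝔼 3)) (ModelWithCorners.prod 𝓣 𝓘(ℝ, ℝ)) ∞ (D.tube J) := by
  have hval : ContMDiff (𝓘(ℝ, ℝ).prod 𝓘(ℝ, 𝔼 3)) (𝓘(ℝ, ℝ).prod 𝓘(ℝ, 𝔼 3)) ∞
      fun p : J × 𝔼 3 ↦ ((p.1 : ℝ), p.2) :=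
    (contMDiff_subtype_val.comp contMDiff_fst).prodMk contMDiff_snd
  exact (D.contMDiff_texp.comp hval).prodMk contMDiff_fst

/-- The tube is smooth on its source. [folklore] -/
theorem contMDiffOn_tube :
    ContMDiffOn (𝓘(ℝ, ℝ).prod 𝓘(ℝ, 𝔼 3)) (ModelWithCorners.prod 𝓣 𝓘(ℝ, ℝ)) ∞ (D.tube J) (D.tube J).source :=
  (D.contMDiff_tube J).contMDiffOn

/-- **The inverse of the tube is smooth** on the target. [folklore] -/
theorem contMDiffOn_tube_symm :
    ContMDiffOn (ModelWithCorners.prod 𝓣 𝓘(ℝ, ℝ)) (𝓘(ℝ, ℝ).prod 𝓘(ℝ, 𝔼 3)) ∞ (D.tube J).symm (D.tube J).target := by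
  have hval : ContMDiff (ModelWithCorners.prod 𝓣 𝓘(ℝ, ℝ)) (ModelWithCorners.prod 𝓣 𝓘(ℝ, ℝ)) ∞
      fun q : ThreeTorus × J ↦ (q.1, (q.2 : ℝ)) :=
    contMDiff_fst.prodMk (contMDiff_subtype_val.comp contMDiff_snd)
  refine contMDiffOn_snd.prodMk ?_
  exact D.contMDiffOn_tlog.comp hval.contMDiffOn fun q hq ↦ hq

end TubeTwist


/-! ### Angle charts of the circle with values in the two pieces -/

section AngleCharts

open Complex

/-- `angA` takes the (excluded) value `1` at the base point `ptA = (1, 0)`. [folklore] -/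
theorem angA_ptA : angA ptA = 1 := by
  have hπ := Real.pi_pos
  rw [angA, toC_ptA, arg_neg_one]
  field_simp
  ring

/-- `angB` takes the value `1` at `ptA = (1, 0)`. [folklore] -/
theorem angB_ptA : angB ptA = 1 := by
  rw [angB, toC_ptA, arg_one, zero_div, add_zero]

/-- `angB` takes the (excluded) value `3/2` at `ptB = (-1, 0)`. [folklore] -/
theorem angB_ptB : angB ptB = 3 / 2 := by
  have hπ := Real.pi_pos
  rw [angB, toC_ptB, arg_neg_one]
  field_simp
  ring

/-- The set `{u | u ≠ ptA}` is open. [folklore] -/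
theorem isOpen_ne_ptA : IsOpen {u : 𝕊 1 | u ≠ ptA} := isOpen_ne_fun continuous_id continuous_const

/-- The set `{u | u ≠ ptB}` is open. [folklore] -/
theorem isOpen_ne_ptB : IsOpen {u : 𝕊 1 | u ≠ ptB} := isOpen_ne_fun continuous_id continuous_const

/-- The first angle as a point of the piece `(0, 1)` (junk value `1/2` at `ptA`). [folklore] -/
def angAPt (u : 𝕊 1) : mappingTorusPieceOne :=
  if h : angA u < 1 then ⟨angA u, mem_mappingTorusPieceOne.2 ⟨(angA_mem_Ioc u).1, h⟩⟩
  else ⟨1 / 2, half_mem_pieceOne⟩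

/-- Away from `ptA`, `angAPt u = angA u`. [folklore] -/
theorem coe_angAPt {u : 𝕊 1} (hu : u ≠ ptA) : (angAPt u : ℝ) = angA u := by
  rw [angAPt, dif_pos (angA_lt_one hu)]

/-- The second angle as a point of the piece `(1/2, 3/2)` (junk value `1` at `ptB`). [folklore] -/
def angBPt (u : 𝕊 1) : mappingTorusPieceTwo :=
  if h : angB u < 3 / 2 then ⟨angB u, mem_mappingTorusPieceTwo.2 ⟨(angB_mem_Ioc u).1, h⟩⟩
  else ⟨1, one_mem_pieceTwo⟩

/-- Away from `ptB`, `angBPt u = angB u`. [folklore] -/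
theorem coe_angBPt {u : 𝕊 1} (hu : u ≠ ptB) : (angBPt u : ℝ) = angB u := by
  rw [angBPt, dif_pos (angB_lt hu)]

/-- `angBPt ptA = 1`. [folklore] -/
theorem coe_angBPt_ptA : (angBPt ptA : ℝ) = 1 := by rw [coe_angBPt ptA_ne_ptB, angB_ptA]

/-- `circlePt s ≠ ptA` for `s ∈ (0, 1)`. [folklore] -/
theorem circlePt_ne_ptA (s : mappingTorusPieceOne) : circlePt s ≠ ptA := by
  intro h
  have h1 := angA_circlePt (θ := (s : ℝ)) (coe_prop_pieceOne s)
  rw [h, angA_ptA] at h1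
  exact (coe_prop_pieceOne s).2.ne h1.symm

/-- `circlePt t ≠ ptB` for `t ∈ (1/2, 3/2)`. [folklore] -/
theorem circlePt_ne_ptB (t : mappingTorusPieceTwo) : circlePt t ≠ ptB := by
  intro h
  have h1 := angB_circlePt (θ := (t : ℝ)) (coe_prop_pieceTwo t)
  rw [h, angB_ptB] at h1
  exact (coe_prop_pieceTwo t).2.ne h1.symm

/-- **The first angle chart** `𝕊¹ ∖ {(1, 0)} ≅ (0, 1)`, `u ↦ angA u`, with inverse
`s ↦ (cos 2πs, sin 2πs)`. [folklore] -/
def angleChartA : OpenPartialHomeomorph (𝕊 1) mappingTorusPieceOne where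
  toFun := angAPt
  invFun s := circlePt s
  source := {u | u ≠ ptA}
  target := univ
  map_source' _ _ := mem_univ _
  map_target' s _ := circlePt_ne_ptA s
  left_inv' u hu := by
    show circlePt (angAPt u) = u
    rw [coe_angAPt hu, circlePt_angA]
  right_inv' s _ := by
    apply Subtype.ext
    show (angAPt (circlePt s) : ℝ) = s
    rw [coe_angAPt (circlePt_ne_ptA s), angA_circlePt (coe_prop_pieceOne s)]
  open_source := isOpen_ne_ptA
  open_target := isOpen_univ
  continuousOn_toFun := by
    rw [Topology.IsInducing.subtypeVal.continuousOn_iff]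
    refine ContinuousOn.congr (f := angA) ?_ fun u hu ↦ coe_angAPt hu
    exact fun u hu ↦ (contMDiffAt_angA hu).continuousAt.continuousWithinAt
  continuousOn_invFun := (continuous_circlePt.comp continuous_subtype_val).continuousOn

/-- **The second angle chart** `𝕊¹ ∖ {(-1, 0)} ≅ (1/2, 3/2)`, `u ↦ angB u`, with inverse
`t ↦ (cos 2πt, sin 2πt)`. [folklore] -/
def angleChartB : OpenPartialHomeomorph (𝕊 1) mappingTorusPieceTwo where
  toFun := angBPt
  invFun t := circlePt t
  source := {u | u ≠ ptB}
  target := univ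
  map_source' _ _ := mem_univ _
  map_target' t _ := circlePt_ne_ptB t
  left_inv' u hu := by
    show circlePt (angBPt u) = u
    rw [coe_angBPt hu, circlePt_angB]
  right_inv' t _ := by
    apply Subtype.ext
    show (angBPt (circlePt t) : ℝ) = t
    rw [coe_angBPt (circlePt_ne_ptB t), angB_circlePt (coe_prop_pieceTwo t)]
  open_source := isOpen_ne_ptB
  open_target := isOpen_univ
  continuousOn_toFun := by
    rw [Topology.IsInducing.subtypeVal.continuousOn_iff]
    refine ContinuousOn.congr (f := angB) ?_ fun u hu ↦ coe_angBPt hu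
    exact fun u hu ↦ (contMDiffAt_angB hu).continuousAt.continuousWithinAt
  continuousOn_invFun := (continuous_circlePt.comp continuous_subtype_val).continuousOn

/-- The source of the first angle chart. [folklore] -/
theorem angleChartA_source : angleChartA.source = {u | u ≠ ptA} := rfl

/-- The source of the second angle chart. [folklore] -/
theorem angleChartB_source : angleChartB.source = {u | u ≠ ptB} := rfl

/-- The first angle chart is `angAPt`. [folklore] -/
theorem angleChartA_apply (u : 𝕊 1) : angleChartA u = angAPt u := rfl

/-- The second angle chart is `angBPt`. [folklore] -/
theorem angleChartB_apply (u : 𝕊 1) : angleChartB u = angBPt u := rfl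

/-- **The first angle chart is smooth.** [folklore] -/
theorem contMDiffOn_angleChartA : ContMDiffOn (𝓡 1) 𝓘(ℝ, ℝ) ∞ angleChartA angleChartA.source := by
  intro u hu
  apply ContMDiffAt.contMDiffWithinAt
  rw [← ContMDiffAt.subtypeVal_comp_iff]
  have hev : (Subtype.val ∘ angleChartA) =ᶠ[𝓝 u] angA := by
    filter_upwards [isOpen_ne_ptA.mem_nhds hu] with v hv
    exact coe_angAPt hv
  exact (contMDiffAt_angA hu).congr_of_eventuallyEq hev

/-- The inverse of the first angle chart is smooth. [folklore] -/
theorem contMDiff_angleChartA_symm : ContMDiff 𝓘(ℝ, ℝ) (𝓡 1) ∞ angleChartA.symm :=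
  contMDiff_circlePt.comp contMDiff_subtype_val

/-- **The second angle chart is smooth.** [folklore] -/
theorem contMDiffOn_angleChartB : ContMDiffOn (𝓡 1) 𝓘(ℝ, ℝ) ∞ angleChartB angleChartB.source := by
  intro u hu
  apply ContMDiffAt.contMDiffWithinAt
  rw [← ContMDiffAt.subtypeVal_comp_iff]
  have hev : (Subtype.val ∘ angleChartB) =ᶠ[𝓝 u] angB := by
    filter_upwards [isOpen_ne_ptB.mem_nhds hu] with v hv
    exact coe_angBPt hv
  exact (contMDiffAt_angB hu).congr_of_eventuallyEq hev

/-- The inverse of the second angle chart is smooth. [folklore] -/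
theorem contMDiff_angleChartB_symm : ContMDiff 𝓘(ℝ, ℝ) (𝓡 1) ∞ angleChartB.symm :=
  contMDiff_circlePt.comp contMDiff_subtype_val

end AngleCharts

/-! ### The tubes over the two pieces, parametrised by `𝕊¹ × ℝ³` -/

namespace TubeTwist

variable (D : TubeTwist)

/-- **The tube over the first piece**, `𝕊¹ × ℝ³ ⇀ T³ × (0, 1)`,
`(u, w) ↦ (texp (angA u) w, angA u)`, defined off `u = ptA`. [folklore] -/
def tubeA : OpenPartialHomeomorph ((𝕊 1) × 𝔼 3) (ThreeTorus × mappingTorusPieceOne) :=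
  (angleChartA.prod (OpenPartialHomeomorph.refl (𝔼 3))) ≫ₕ D.tube mappingTorusPieceOne

/-- **The tube over the second piece**, `𝕊¹ × ℝ³ ⇀ T³ × (1/2, 3/2)`,
`(u, w) ↦ (texp (angB u) w, angB u)`, defined off `u = ptB`. [folklore] -/
def tubeB : OpenPartialHomeomorph ((𝕊 1) × 𝔼 3) (ThreeTorus × mappingTorusPieceTwo) :=
  (angleChartB.prod (OpenPartialHomeomorph.refl (𝔼 3))) ≫ₕ D.tube mappingTorusPieceTwo

/-- The formula for the first tube. [folklore] -/
theorem tubeA_apply (p : (𝕊 1) × 𝔼 3) : D.tubeA p = (D.texp (angAPt p.1) p.2, angAPt p.1) := rfl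

/-- The formula for the second tube. [folklore] -/
theorem tubeB_apply (p : (𝕊 1) × 𝔼 3) : D.tubeB p = (D.texp (angBPt p.1) p.2, angBPt p.1) := rfl

/-- The first tube is defined off `ptA`. [folklore] -/
theorem mem_tubeA_source {p : (𝕊 1) × 𝔼 3} : p ∈ D.tubeA.source ↔ p.1 ≠ ptA := by
  simp [tubeA, angleChartA_source]

/-- The second tube is defined off `ptB`. [folklore] -/
theorem mem_tubeB_source {p : (𝕊 1) × 𝔼 3} : p ∈ D.tubeB.source ↔ p.1 ≠ ptB := by
  simp [tubeB, angleChartB_source]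

/-- **The first tube is smooth** on its source. [folklore] -/
theorem contMDiffOn_tubeA : ContMDiffOn ((𝓡 1).prod 𝓘(ℝ, 𝔼 3)) (ModelWithCorners.prod 𝓣 𝓘(ℝ, ℝ)) ∞
    D.tubeA D.tubeA.source :=
  contMDiffOn_trans_of (contMDiffOn_prod_refl_of contMDiffOn_angleChartA) (D.contMDiffOn_tube _)

/-- The inverse of the first tube is smooth on its target. [folklore] -/
theorem contMDiffOn_tubeA_symm :
    ContMDiffOn (ModelWithCorners.prod 𝓣 𝓘(ℝ, ℝ)) ((𝓡 1).prod 𝓘(ℝ, 𝔼 3)) ∞ D.tubeA.symm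
      D.tubeA.target :=
  contMDiffOn_trans_symm_of (contMDiffOn_prod_refl_symm_of contMDiff_angleChartA_symm.contMDiffOn)
    (D.contMDiffOn_tube_symm _)

/-- **The second tube is smooth** on its source. [folklore] -/
theorem contMDiffOn_tubeB : ContMDiffOn ((𝓡 1).prod 𝓘(ℝ, 𝔼 3)) (ModelWithCorners.prod 𝓣 𝓘(ℝ, ℝ)) ∞
    D.tubeB D.tubeB.source :=
  contMDiffOn_trans_of (contMDiffOn_prod_refl_of contMDiffOn_angleChartB) (D.contMDiffOn_tube _)

/-- The inverse of the second tube is smooth on its target. [folklore] -/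
theorem contMDiffOn_tubeB_symm :
    ContMDiffOn (ModelWithCorners.prod 𝓣 𝓘(ℝ, ℝ)) ((𝓡 1).prod 𝓘(ℝ, 𝔼 3)) ∞ D.tubeB.symm
      D.tubeB.target :=
  contMDiffOn_trans_symm_of (contMDiffOn_prod_refl_symm_of contMDiff_angleChartB_symm.contMDiffOn)
    (D.contMDiffOn_tube_symm _)

end TubeTwist


/-! ### Entry bounds for `3 × 3` matrices -/

section Bounds

/-- The sum of the absolute values of the entries of a real `3 × 3` matrix, a bound for each entry
(an elementary stand-in for the entrywise sup norm of `Matrix.normedAddCommGroup`, which Mathlib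
deliberately does not register as a global instance; only the two inequalities below are used). [folklore] -/
def entryBound (M : Matrix (Fin 3) (Fin 3) ℝ) : ℝ := ∑ i, ∑ j, |M i j|

/-- Each entry is bounded by `entryBound`. [folklore] -/
theorem abs_le_entryBound (M : Matrix (Fin 3) (Fin 3) ℝ) (i j : Fin 3) : |M i j| ≤ entryBound M :=
  calc |M i j| ≤ ∑ j', |M i j'| :=
        Finset.single_le_sum (f := fun j' ↦ |M i j'|) (fun _ _ ↦ abs_nonneg _) (Finset.mem_univ j)
    _ ≤ ∑ i', ∑ j', |M i' j'| :=
        Finset.single_le_sum (f := fun i' ↦ ∑ j', |M i' j'|)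
          (fun _ _ ↦ Finset.sum_nonneg fun _ _ ↦ abs_nonneg _) (Finset.mem_univ i)

/-- `entryBound` is nonnegative. [folklore] -/
theorem entryBound_nonneg (M : Matrix (Fin 3) (Fin 3) ℝ) : 0 ≤ entryBound M :=
  Finset.sum_nonneg fun _ _ ↦ Finset.sum_nonneg fun _ _ ↦ abs_nonneg _

/-- Entries of a product: if `|M i j| ≤ K` and `|N i j| ≤ L` then `|(M N) i j| ≤ 3 K L`. [folklore] -/
theorem abs_mul_apply_le {M N : Matrix (Fin 3) (Fin 3) ℝ} {K L : ℝ} (hM : ∀ i j, |M i j| ≤ K)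
    (hN : ∀ i j, |N i j| ≤ L) (i j : Fin 3) : |(M * N) i j| ≤ 3 * K * L := by
  have hK : 0 ≤ K := (abs_nonneg _).trans (hM 0 0)
  rw [Matrix.mul_apply]
  calc |∑ k, M i k * N k j| ≤ ∑ k, |M i k * N k j| := Finset.abs_sum_le_sum_abs _ _
    _ ≤ ∑ _k : Fin 3, K * L := Finset.sum_le_sum fun k _ ↦ by
        rw [abs_mul]
        exact mul_le_mul (hM i k) (hN k j) (abs_nonneg _) hK
    _ = 3 * K * L := by simp [mul_assoc]

end Bounds

/-! ### The real matrix of `A ∈ SL(3, ℤ)`: multiplicativity -/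

section SLReal

/-- `slRealMatrix` is multiplicative. [folklore] -/
theorem slRealMatrix_mul (A B : Matrix.SpecialLinearGroup (Fin 3) ℤ) :
    slRealMatrix (A * B) = slRealMatrix A * slRealMatrix B := by
  simp only [slRealMatrix_eq_coe_map, map_mul, Matrix.SpecialLinearGroup.coe_mul]

/-- `slRealMatrix 1 = 1`. [folklore] -/
theorem slRealMatrix_one : slRealMatrix (1 : Matrix.SpecialLinearGroup (Fin 3) ℤ) = 1 := by
  rw [slRealMatrix_eq_coe_map, map_one, Matrix.SpecialLinearGroup.coe_one]

/-- `slRealMatrix A * slRealMatrix A⁻¹ = 1`. [folklore] -/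
theorem slRealMatrix_mul_inv (A : Matrix.SpecialLinearGroup (Fin 3) ℤ) :
    slRealMatrix A * slRealMatrix A⁻¹ = 1 := by
  rw [← slRealMatrix_mul, mul_inv_cancel, slRealMatrix_one]

/-- `slRealMatrix A⁻¹ * slRealMatrix A = 1`. [folklore] -/
theorem slRealMatrix_inv_mul (A : Matrix.SpecialLinearGroup (Fin 3) ℤ) :
    slRealMatrix A⁻¹ * slRealMatrix A = 1 := by
  rw [← slRealMatrix_mul, inv_mul_cancel, slRealMatrix_one]

/-- The equivariance `torusMap A (expT v) = expT (A v)` in terms of `slRealMatrix`. [folklore] -/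
theorem torusMap_expT' (A : Matrix.SpecialLinearGroup (Fin 3) ℤ) (v : 𝔼 3) :
    torusMap (A : Matrix (Fin 3) (Fin 3) ℤ) (expT v) = expT (mulVecE (slRealMatrix A) v) :=
  torusMap_expT _ v

end SLReal

/-! ### The twisting data of `A ∈ SL(3, ℤ)` along a path `γ` from `1` to `A` -/

namespace SmoothMatrixPath

variable {n : Type*} [Fintype n] [DecidableEq n] {M : Matrix n n ℝ} (γ : SmoothMatrixPath M)

/-- A uniform bound for the entries of a smooth matrix path (a choice from `exists_bound`). [folklore] -/
def bound : ℝ := γ.exists_bound.choose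

/-- The chosen bound is nonnegative. [folklore] -/
theorem bound_nonneg : 0 ≤ γ.bound := γ.exists_bound.choose_spec.1

/-- The entries of the path are bounded by the chosen bound. [folklore] -/
theorem abs_le_bound (θ : ℝ) (i j : n) : |γ.toFun θ i j| ≤ γ.bound := γ.exists_bound.choose_spec.2 θ i j

end SmoothMatrixPath

section Twist

variable (A : Matrix.SpecialLinearGroup (Fin 3) ℤ) (γ : SmoothMatrixPath (slRealMatrix A))

/-- A common entry bound for the matrices `γ(θ)` and `A γ(θ)`. [folklore] -/
def twistBound : ℝ := 3 * (entryBound (slRealMatrix A) + 1) * (γ.bound + 1)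

/-- The entries of `γ(θ)` are bounded by `twistBound`. [folklore] -/
theorem abs_path_le_twistBound (θ : ℝ) (i j : Fin 3) : |γ.toFun θ i j| ≤ twistBound A γ := by
  have h1 := γ.abs_le_bound θ i j
  have h2 := entryBound_nonneg (slRealMatrix A)
  have h3 := γ.bound_nonneg
  rw [twistBound]
  nlinarith

/-- The entries of `A γ(θ)` are bounded by `twistBound`. [folklore] -/
theorem abs_mul_path_le_twistBound (θ : ℝ) (i j : Fin 3) :
    |(slRealMatrix A * γ.toFun θ) i j| ≤ twistBound A γ := by
  have h1 := abs_mul_apply_le (abs_le_entryBound (slRealMatrix A)) (γ.abs_le_bound θ) i j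
  have h2 := entryBound_nonneg (slRealMatrix A)
  have h3 := γ.bound_nonneg
  rw [twistBound]
  nlinarith

/-- `twistBound` is nonnegative. [folklore] -/
theorem twistBound_nonneg : 0 ≤ twistBound A γ := by
  have h2 := entryBound_nonneg (slRealMatrix A)
  have h3 := γ.bound_nonneg
  rw [twistBound]
  positivity

/-- **The radius of the tube**: `ε = π / (3 K + 1)`, so that matrices with entries bounded by
`K = twistBound A γ` map the `ε`-ball into the cube `(-π, π)³`. [folklore] -/
def twistRadius : ℝ := π / (3 * twistBound A γ + 1)

/-- The radius of the tube is positive. [folklore] -/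
theorem twistRadius_pos : 0 < twistRadius A γ := by
  have := twistBound_nonneg A γ
  rw [twistRadius]
  positivity

/-- A matrix with entries bounded by `twistBound` maps the ball of radius `twistRadius` into the
cube `(-π, π)³`. [folklore] -/
theorem abs_mulVecE_lt_pi {M : Matrix (Fin 3) (Fin 3) ℝ} (hM : ∀ i j, |M i j| ≤ twistBound A γ)
    (v : 𝔼 3) (hv : ‖v‖ < twistRadius A γ) (i : Fin 3) : |mulVecE M v i| < π := by
  have hK := twistBound_nonneg A γ
  have hπ := Real.pi_pos
  have h1 : |mulVecE M v i| ≤ 3 * twistBound A γ * ‖v‖ := by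
    simpa using abs_mulVecE_apply_le hM v i
  have h2 : 3 * twistBound A γ * ‖v‖ ≤ 3 * twistBound A γ * twistRadius A γ :=
    mul_le_mul_of_nonneg_left hv.le (by positivity)
  have h3 : 3 * twistBound A γ * twistRadius A γ < π := by
    rw [twistRadius, mul_div_assoc', div_lt_iff₀ (by positivity)]
    nlinarith
  linarith

/-- **The twisting datum over the first piece**: `s ↦ γ(2s)`, equal to `1` for `s ≤ 0` and to `A`
for `s ≥ 1/2`. [folklore] -/
def twistA : TubeTwist where
  ε := twistRadius A γ
  ε_pos := twistRadius_pos A γ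
  mat s := γ.toFun (2 * s)
  inv s := γ.inv (2 * s)
  contDiff_mat i j := (γ.contDiff_apply i j).comp (contDiff_const.mul contDiff_id)
  contDiff_inv i j := (γ.contDiff_inv_apply i j).comp (contDiff_const.mul contDiff_id)
  mat_mul_inv _ := γ.mul_inv _
  inv_mul_mat _ := γ.inv_mul _
  abs_lt_pi _ v hv i := abs_mulVecE_lt_pi A γ (abs_path_le_twistBound A γ _) v hv i

/-- **The twisting datum over the second piece**: `t ↦ A γ(2(t - 1))`, equal to `A` for `t ≤ 1`.
[folklore] -/
def twistB : TubeTwist where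
  ε := twistRadius A γ
  ε_pos := twistRadius_pos A γ
  mat t := slRealMatrix A * γ.toFun (2 * (t - 1))
  inv t := γ.inv (2 * (t - 1)) * slRealMatrix A⁻¹
  contDiff_mat := SmoothMatrixPath.contDiff_mul_apply (fun _ _ ↦ contDiff_const)
    fun i j ↦ (γ.contDiff_apply i j).comp (contDiff_const.mul (contDiff_id.sub contDiff_const))
  contDiff_inv := SmoothMatrixPath.contDiff_mul_apply
    (fun i j ↦ (γ.contDiff_inv_apply i j).comp (contDiff_const.mul (contDiff_id.sub contDiff_const)))
    fun _ _ ↦ contDiff_const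
  mat_mul_inv t := by
    rw [Matrix.mul_assoc, ← Matrix.mul_assoc (γ.toFun _), γ.mul_inv, Matrix.one_mul,
      slRealMatrix_mul_inv]
  inv_mul_mat t := by
    rw [Matrix.mul_assoc, ← Matrix.mul_assoc (slRealMatrix A⁻¹), slRealMatrix_inv_mul,
      Matrix.one_mul, γ.inv_mul]
  abs_lt_pi t v hv i := abs_mulVecE_lt_pi A γ (abs_mul_path_le_twistBound A γ _) v hv i

/-- The two twisting data have the same radius, hence the same shrinking map. [folklore] -/
theorem shrink_twistB : (twistB A γ).shrink = (twistA A γ).shrink := rfl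

/-- **The second tube is the image of the first under `A`**:
`texp_B t w = torusMap A (texp_A (t - 1) w)`. [folklore] -/
theorem texp_twistB (t : ℝ) (w : 𝔼 3) :
    (twistB A γ).texp t w = torusMap (A : Matrix (Fin 3) (Fin 3) ℤ) ((twistA A γ).texp (t - 1) w) := by
  simp only [TubeTwist.texp, shrink_twistB, torusMap_expT', mulVecE_mulVecE]
  rfl

/-- For `s ≥ 1/2` the first twist is `A`: `texp_A s w = expT (A • shrink w)`. [folklore] -/
theorem texp_twistA_of_le {s : ℝ} (hs : 1 / 2 ≤ s) (w : 𝔼 3) :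
    (twistA A γ).texp s w = expT (mulVecE (slRealMatrix A) ((twistA A γ).shrink w)) := by
  have h : γ.toFun (2 * s) = slRealMatrix A := γ.eq_self _ (by linarith)
  simp only [TubeTwist.texp]
  exact congrArg (fun N ↦ expT (mulVecE N _)) h

/-- For `t ≤ 1` the second twist is `A`: `texp_B t w = expT (A • shrink w)`. [folklore] -/
theorem texp_twistB_of_le {t : ℝ} (ht : t ≤ 1) (w : 𝔼 3) :
    (twistB A γ).texp t w = expT (mulVecE (slRealMatrix A) ((twistA A γ).shrink w)) := by
  have h : slRealMatrix A * γ.toFun (2 * (t - 1)) = slRealMatrix A := by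
    rw [γ.eq_one _ (by linarith), Matrix.mul_one]
  simp only [TubeTwist.texp, shrink_twistB]
  exact congrArg (fun N ↦ expT (mulVecE N _)) h

end Twist


/-! ### The Cappell–Shaneson mapping torus and the tube around its section circle -/

section SectionNbhd

/-- The model identification `(ℝ¹ × ℝ¹ × ℝ¹) × ℝ ≅ ℝ⁴` for the charts of the mapping torus of
`T³` (any linear isomorphism; dimension count). [folklore] -/
def linTorusModel : ((𝔼 1 × (𝔼 1 × 𝔼 1)) × ℝ) ≃L[ℝ] 𝔼 4 :=
  ContinuousLinearEquiv.ofFinrankEq (by simp)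

/-- The model identification `ℝ¹ × ℝ³ ≅ (ℝ¹ × ℝ¹ × ℝ¹) × ℝ` between the models of `𝕊¹ × ℝ³` and
of the cylinders `T³ × J` (any linear isomorphism; dimension count). [folklore] -/
def linTubeModel : (𝔼 1 × 𝔼 3) ≃L[ℝ] ((𝔼 1 × (𝔼 1 × 𝔼 1)) × ℝ) :=
  ContinuousLinearEquiv.ofFinrankEq (by simp)

variable (A : Matrix.SpecialLinearGroup (Fin 3) ℤ)

/-- **The gluing datum of the Cappell–Shaneson mapping torus** of `A ∈ SL(3, ℤ)`: the mapping
torus datum of `torusDiffeomorph A` with charts valued in `ℝ⁴`. [folklore] -/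
abbrev csGlueData : SmoothGlueData (ModelWithCorners.prod 𝓣 𝓘(ℝ, ℝ)) (ModelWithCorners.prod 𝓣 𝓘(ℝ, ℝ))
    (ThreeTorus × mappingTorusPieceOne) (ThreeTorus × mappingTorusPieceTwo) (𝔼 4) :=
  mappingTorusGlueData (torusDiffeomorph A) linTorusModel

/-- **The Cappell–Shaneson mapping torus** `T_A = T³ × ℝ / (x, s) ∼ (A x, s + 1)` of
`A ∈ SL(3, ℤ)`, as the glued manifold `MappingTorusGlued (torusDiffeomorph A) linTorusModel`
(a closed smooth 4-manifold charted on `ℝ⁴`; Cappell–Shaneson 1976, §2). [folklore] -/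
abbrev CSTorus : Type := MappingTorusGlued (torusDiffeomorph A) linTorusModel

variable (γ : SmoothMatrixPath (slRealMatrix A))

/-- **Compatibility of the two tubes with the gluing.** Away from `ptA` and `ptB` the two tubes
define the same point of the mapping torus: on the lower half circle (`angB = angA > 1/2`) both
read `(expT (A • shrink w), angA u)`, on the upper half circle (`angB = angA + 1`, `angA < 1/2`)
the second is `(A · texp_A, angA u + 1) ∼ (texp_A, angA u)`. [folklore] -/
theorem inl_tubeA_eq_inr_tubeB {u : 𝕊 1} (hA : u ≠ ptA) (hB : u ≠ ptB) (w : 𝔼 3) :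
    (csGlueData A).inl ((twistA A γ).tubeA (u, w)) = (csGlueData A).inr ((twistB A γ).tubeB (u, w)) := by
  rw [mappingTorusGlued_inl_eq_inr_iff, TubeTwist.tubeA_apply, TubeTwist.tubeB_apply, mappingTorusRel]
  dsimp only
  rw [coe_angAPt hA, coe_angBPt hB, coe_torusDiffeomorph]
  rcases angB_eq_of_ne hA hB with ⟨hlt, h1⟩ | ⟨hgt, h0⟩
  · right
    refine ⟨h1, ?_⟩
    rw [texp_twistB, h1, add_sub_cancel_right]
  · left
    refine ⟨h0, ?_⟩
    rw [h0, texp_twistB_of_le A γ (angA_mem_Ioc u).2, texp_twistA_of_le A γ hgt.le]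

open scoped Classical in
/-- **The tube around the section circle** `ν : 𝕊¹ × ℝ³ → T_A`: `inl ∘ tubeA` off `ptA` and
`inr ∘ tubeB` at (hence near) `ptA`. [folklore] -/
def secNbhdFun (p : (𝕊 1) × 𝔼 3) : CSTorus A :=
  if p.1 = ptA then (csGlueData A).inr ((twistB A γ).tubeB p)
  else (csGlueData A).inl ((twistA A γ).tubeA p)

/-- Off `ptA` the tube is `inl ∘ tubeA`. [folklore] -/
theorem secNbhdFun_of_ne {p : (𝕊 1) × 𝔼 3} (hp : p.1 ≠ ptA) :
    secNbhdFun A γ p = (csGlueData A).inl ((twistA A γ).tubeA p) := by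
  rw [secNbhdFun, if_neg hp]

/-- Off `ptB` the tube is `inr ∘ tubeB`. [folklore] -/
theorem secNbhdFun_of_ne_ptB {p : (𝕊 1) × 𝔼 3} (hp : p.1 ≠ ptB) :
    secNbhdFun A γ p = (csGlueData A).inr ((twistB A γ).tubeB p) := by
  by_cases h : p.1 = ptA
  · rw [secNbhdFun, if_pos h]
  · rw [secNbhdFun_of_ne A γ h]
    exact inl_tubeA_eq_inr_tubeB A γ h hp p.2

/-- Near a point off `ptA` the tube is `inl ∘ tubeA`. [folklore] -/
theorem secNbhdFun_eventuallyEq_inl {p : (𝕊 1) × 𝔼 3} (hp : p.1 ≠ ptA) :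
    secNbhdFun A γ =ᶠ[𝓝 p] (csGlueData A).inl ∘ (twistA A γ).tubeA := by
  filter_upwards [(isOpen_ne_ptA.preimage continuous_fst).mem_nhds hp] with q hq
  exact secNbhdFun_of_ne A γ hq

/-- Near a point off `ptB` the tube is `inr ∘ tubeB`. [folklore] -/
theorem secNbhdFun_eventuallyEq_inr {p : (𝕊 1) × 𝔼 3} (hp : p.1 ≠ ptB) :
    secNbhdFun A γ =ᶠ[𝓝 p] (csGlueData A).inr ∘ (twistB A γ).tubeB := by
  filter_upwards [(isOpen_ne_ptB.preimage continuous_fst).mem_nhds hp] with q hq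
  exact secNbhdFun_of_ne_ptB A γ hq

/-- A point is off `ptA` or off `ptB`. [folklore] -/
theorem ne_ptA_or_ne_ptB (u : 𝕊 1) : u ≠ ptA ∨ u ≠ ptB := by
  by_cases h : u = ptA
  · exact Or.inr (h ▸ ptA_ne_ptB)
  · exact Or.inl h

/-- **The tube is an immersion** at every point (with trivial complement: a local
diffeomorphism), being locally `inl ∘ tubeA` or `inr ∘ tubeB` with `tubeA`, `tubeB` partial
diffeomorphisms and `inl`, `inr` open smooth embeddings. [folklore] -/
theorem isImmersionAtOfComplement_secNbhdFun (p : (𝕊 1) × 𝔼 3) :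
    Manifold.IsImmersionAtOfComplement Unit ((𝓡 1).prod 𝓘(ℝ, 𝔼 3)) 𝓘(ℝ, 𝔼 4) ∞
      (secNbhdFun A γ) p := by
  rcases ne_ptA_or_ne_ptB p.1 with h | h
  · have h1 : Manifold.IsImmersionAtOfComplement Unit ((𝓡 1).prod 𝓘(ℝ, 𝔼 3))
        (ModelWithCorners.prod 𝓣 𝓘(ℝ, ℝ)) ∞ (twistA A γ).tubeA p :=
      isImmersionAtOfComplement_of_eventuallyEq_openPartialHomeomorph (twistA A γ).tubeA
        (twistA A γ).contMDiffOn_tubeA (twistA A γ).contMDiffOn_tubeA_symm linTubeModel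
        (((twistA A γ).mem_tubeA_source).2 h) EventuallyEq.rfl
    exact ((csGlueData A).isImmersionAtOfComplement_inl_comp h1).congr_of_eventuallyEq
      (secNbhdFun_eventuallyEq_inl A γ h).symm
  · have h1 : Manifold.IsImmersionAtOfComplement Unit ((𝓡 1).prod 𝓘(ℝ, 𝔼 3))
        (ModelWithCorners.prod 𝓣 𝓘(ℝ, ℝ)) ∞ (twistB A γ).tubeB p :=
      isImmersionAtOfComplement_of_eventuallyEq_openPartialHomeomorph (twistB A γ).tubeB
        (twistB A γ).contMDiffOn_tubeB (twistB A γ).contMDiffOn_tubeB_symm linTubeModel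
        (((twistB A γ).mem_tubeB_source).2 h) EventuallyEq.rfl
    exact ((csGlueData A).isImmersionAtOfComplement_inr_comp h1).congr_of_eventuallyEq
      (secNbhdFun_eventuallyEq_inr A γ h).symm

/-- The tube is an immersion. [folklore] -/
theorem isImmersion_secNbhdFun :
    Manifold.IsImmersion ((𝓡 1).prod 𝓘(ℝ, 𝔼 3)) 𝓘(ℝ, 𝔼 4) ∞ (secNbhdFun A γ) :=
  Manifold.IsImmersionOfComplement.isImmersion (isImmersionAtOfComplement_secNbhdFun A γ)

/-- The tube is continuous. [folklore] -/
theorem continuous_secNbhdFun : Continuous (secNbhdFun A γ) :=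
  continuous_iff_continuousAt.2 fun p ↦ (isImmersionAtOfComplement_secNbhdFun A γ p).continuousAt

/-- The level of a point `inr (tubeB (ptA, w))` is `1`, which is not the level `angA u ∈ (0, 1)` of
any point `inl (tubeA (u, w'))`: the fibre over `ptA` does not meet the rest of the tube. [folklore] -/
theorem inl_tubeA_ne_inr_tubeB {p q : (𝕊 1) × 𝔼 3} (hp : p.1 ≠ ptA) (hq : q.1 = ptA) :
    (csGlueData A).inl ((twistA A γ).tubeA p) ≠ (csGlueData A).inr ((twistB A γ).tubeB q) := by
  intro h
  rw [mappingTorusGlued_inl_eq_inr_iff, TubeTwist.tubeA_apply, TubeTwist.tubeB_apply,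
    mappingTorusRel] at h
  dsimp only at h
  rw [hq, coe_angBPt_ptA, coe_angAPt hp] at h
  rcases h with ⟨h1, -⟩ | ⟨h1, -⟩
  · exact (angA_lt_one hp).ne h1.symm
  · linarith [(angA_mem_Ioc p.1).1]

/-- **The tube is injective.** [folklore] -/
theorem injective_secNbhdFun : Injective (secNbhdFun A γ) := by
  intro p q hpq
  by_cases hp : p.1 = ptA <;> by_cases hq : q.1 = ptA
  · rw [secNbhdFun, if_pos hp, secNbhdFun, if_pos hq] at hpq
    exact (twistB A γ).tubeB.injOn (((twistB A γ).mem_tubeB_source).2 (hp ▸ ptA_ne_ptB))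
      (((twistB A γ).mem_tubeB_source).2 (hq ▸ ptA_ne_ptB)) ((csGlueData A).inr_injective hpq)
  · rw [secNbhdFun, if_pos hp, secNbhdFun, if_neg hq] at hpq
    exact absurd hpq.symm (inl_tubeA_ne_inr_tubeB A γ hq hp)
  · rw [secNbhdFun, if_neg hp, secNbhdFun, if_pos hq] at hpq
    exact absurd hpq (inl_tubeA_ne_inr_tubeB A γ hp hq)
  · rw [secNbhdFun, if_neg hp, secNbhdFun, if_neg hq] at hpq
    exact (twistA A γ).tubeA.injOn (((twistA A γ).mem_tubeA_source).2 hp)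
      (((twistA A γ).mem_tubeA_source).2 hq) ((csGlueData A).inl_injective hpq)

/-- **The tube is an open map**: locally it is an open partial homeomorphism followed by an open
embedding. [folklore] -/
theorem isOpenMap_secNbhdFun : IsOpenMap (secNbhdFun A γ) := by
  refine isOpenMap_iff_nhds_le.2 fun p ↦ ?_
  rcases ne_ptA_or_ne_ptB p.1 with h | h
  · have hev := secNbhdFun_eventuallyEq_inl A γ h
    rw [Filter.map_congr hev, ← Filter.map_map,
      (twistA A γ).tubeA.map_nhds_eq (((twistA A γ).mem_tubeA_source).2 h),
      (csGlueData A).isOpenEmbedding_inl.map_nhds_eq, hev.eq_of_nhds]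
    exact le_rfl
  · have hev := secNbhdFun_eventuallyEq_inr A γ h
    rw [Filter.map_congr hev, ← Filter.map_map,
      (twistB A γ).tubeB.map_nhds_eq (((twistB A γ).mem_tubeB_source).2 h),
      (csGlueData A).isOpenEmbedding_inr.map_nhds_eq, hev.eq_of_nhds]
    exact le_rfl

/-- The tube is an open embedding. [folklore] -/
theorem isOpenEmbedding_secNbhdFun : Topology.IsOpenEmbedding (secNbhdFun A γ) :=
  .of_continuous_injective_isOpenMap (continuous_secNbhdFun A γ) (injective_secNbhdFun A γ)
    (isOpenMap_secNbhdFun A γ)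

/-- **The tube is a smooth embedding** `𝕊¹ × ℝ³ ↪ T_A`. [folklore] -/
theorem isSmoothEmbedding_secNbhdFun :
    Manifold.IsSmoothEmbedding ((𝓡 1).prod 𝓘(ℝ, 𝔼 3)) (𝓡 4) ∞ (secNbhdFun A γ) :=
  ⟨isImmersion_secNbhdFun A γ, (isOpenEmbedding_secNbhdFun A γ).isEmbedding⟩

/-! ### The section circle -/

/-- **The section circle** `c : 𝕊¹ → T_A` of the Cappell–Shaneson mapping torus through the
fixed point `1 ∈ T³` — the zero section of the tube: `c u = inl (1, angA u)` off `ptA` and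
`c ptA = inr (1, 1)` (Cappell–Shaneson 1976, §2). [folklore] -/
def sectionCircle (u : 𝕊 1) : CSTorus A := secNbhdFun A γ (u, 0)

/-- Off `ptA`, `c u = inl (1, angA u)`. [folklore] -/
theorem sectionCircle_of_ne {u : 𝕊 1} (hu : u ≠ ptA) :
    sectionCircle A γ u = (csGlueData A).inl (1, angAPt u) := by
  rw [sectionCircle, secNbhdFun_of_ne A γ hu, TubeTwist.tubeA_apply, TubeTwist.texp_zero]

/-- Off `ptB`, `c u = inr (1, angB u)`. [folklore] -/
theorem sectionCircle_of_ne_ptB {u : 𝕊 1} (hu : u ≠ ptB) :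
    sectionCircle A γ u = (csGlueData A).inr (1, angBPt u) := by
  rw [sectionCircle, secNbhdFun_of_ne_ptB A γ hu, TubeTwist.tubeB_apply, TubeTwist.texp_zero]

/-- **The tubular neighbourhood of the section circle** as a `CircleNbhd`: the tube
`secNbhdFun A γ` is an open smooth embedding `𝕊¹ × ℝ³ ↪ T_A` with zero section `c`
(the framing determined by the path `γ`; Cappell–Shaneson 1976, §2). [folklore] -/
def sectionCircleNbhd : CircleNbhd (𝓡 4) (sectionCircle A γ) where
  toFun := secNbhdFun A γ
  isSmoothEmbedding := isSmoothEmbedding_secNbhdFun A γ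
  isOpen_range := (isOpenMap_secNbhdFun A γ).isOpen_range
  apply_zero _ := rfl

/-- **The section circle is an immersion** with complement `ℝ³` at every point: it is the zero
section of the partial diffeomorphisms `tubeA`, `tubeB` followed by `inl`, `inr`. [folklore] -/
theorem isImmersionAtOfComplement_sectionCircle (u : 𝕊 1) :
    Manifold.IsImmersionAtOfComplement (𝔼 3) (𝓡 1) 𝓘(ℝ, 𝔼 4) ∞ (sectionCircle A γ) u := by
  rcases ne_ptA_or_ne_ptB u with h | h
  · have h1 : Manifold.IsImmersionAtOfComplement (𝔼 3) (𝓡 1) (ModelWithCorners.prod 𝓣 𝓘(ℝ, ℝ)) ∞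
        (fun v ↦ (twistA A γ).tubeA (v, 0)) u :=
      isImmersionAtOfComplement_of_eventuallyEq_prod (twistA A γ).tubeA
        (twistA A γ).contMDiffOn_tubeA (twistA A γ).contMDiffOn_tubeA_symm linTubeModel
        (((twistA A γ).mem_tubeA_source).2 h) EventuallyEq.rfl
    refine ((csGlueData A).isImmersionAtOfComplement_inl_comp h1).congr_of_eventuallyEq ?_
    filter_upwards [isOpen_ne_ptA.mem_nhds h] with v hv
    exact (secNbhdFun_of_ne A γ (p := (v, 0)) hv).symm
  · have h1 : Manifold.IsImmersionAtOfComplement (𝔼 3) (𝓡 1) (ModelWithCorners.prod 𝓣 𝓘(ℝ, ℝ)) ∞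
        (fun v ↦ (twistB A γ).tubeB (v, 0)) u :=
      isImmersionAtOfComplement_of_eventuallyEq_prod (twistB A γ).tubeB
        (twistB A γ).contMDiffOn_tubeB (twistB A γ).contMDiffOn_tubeB_symm linTubeModel
        (((twistB A γ).mem_tubeB_source).2 h) EventuallyEq.rfl
    refine ((csGlueData A).isImmersionAtOfComplement_inr_comp h1).congr_of_eventuallyEq ?_
    filter_upwards [isOpen_ne_ptB.mem_nhds h] with v hv
    exact (secNbhdFun_of_ne_ptB A γ (p := (v, 0)) hv).symm

/-- The section circle is continuous. [folklore] -/
theorem continuous_sectionCircle : Continuous (sectionCircle A γ) :=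
  (continuous_secNbhdFun A γ).comp (continuous_id.prodMk continuous_const)

/-- The section circle is injective. [folklore] -/
theorem injective_sectionCircle : Injective (sectionCircle A γ) := fun _ _ h ↦
  congrArg Prod.fst (injective_secNbhdFun A γ h)

/-- **The section circle is a smoothly embedded circle** in the Cappell–Shaneson mapping torus
(Cappell–Shaneson 1976, §2). [folklore] -/
theorem isSmoothEmbedding_sectionCircle :
    Manifold.IsSmoothEmbedding (𝓡 1) (𝓡 4) ∞ (sectionCircle A γ) :=
  ⟨Manifold.IsImmersionOfComplement.isImmersion (isImmersionAtOfComplement_sectionCircle A γ),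
    ((continuous_sectionCircle A γ).isClosedEmbedding (injective_sectionCircle A γ)).isEmbedding⟩

/-- **The image of the section circle** is `inl ({1} × (0, 1)) ∪ inr ({1} × (1/2, 3/2))`, the
section through the fixed point `1` of `torusDiffeomorph A` (Cappell–Shaneson 1976, §2). [folklore] -/
theorem range_sectionCircle : range (sectionCircle A γ) =
    (csGlueData A).inl '' ({1} ×ˢ univ) ∪ (csGlueData A).inr '' ({1} ×ˢ univ) := by
  apply Subset.antisymm
  · rintro _ ⟨u, rfl⟩
    rcases ne_ptA_or_ne_ptB u with h | h
    · exact Or.inl ⟨(1, angAPt u), ⟨rfl, mem_univ _⟩, (sectionCircle_of_ne A γ h).symm⟩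
    · exact Or.inr ⟨(1, angBPt u), ⟨rfl, mem_univ _⟩, (sectionCircle_of_ne_ptB A γ h).symm⟩
  · rintro _ (⟨⟨z, s⟩, ⟨hz, -⟩, rfl⟩ | ⟨⟨z, t⟩, ⟨hz, -⟩, rfl⟩)
    · rw [mem_singleton_iff] at hz
      subst hz
      refine ⟨circlePt s, ?_⟩
      rw [sectionCircle_of_ne A γ (circlePt_ne_ptA s)]
      congr 2
      exact angleChartA.right_inv (mem_univ s)
    · rw [mem_singleton_iff] at hz
      subst hz
      refine ⟨circlePt t, ?_⟩
      rw [sectionCircle_of_ne_ptB A γ (circlePt_ne_ptB t)]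
      congr 2
      exact angleChartB.right_inv (mem_univ t)

end SectionNbhd

/-! ### Summary: the input of the Cappell–Shaneson surgery -/

/-- **The mapping torus of `A ∈ SL(3, ℤ)` with its section circle and tubular neighbourhood**
(explicit-witness form of the named fact `Literature.Topology.FourManifolds.exists_mappingTorus_sectionCircleNbhd` of
`CircleSurgeryProofs`). For every `A ∈ SL(3, ℤ)` the glued mapping torus `T_A = CSTorus A` of
`torusDiffeomorph A` is a closed smooth 4-manifold, an open gluing of `T³ × (0, 1)` and
`T³ × (1/2, 3/2)` along `mappingTorusRel (torusDiffeomorph A)` with witnesses `inl`, `inr`; the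
section through the fixed point `1` is a smoothly embedded circle `c` with image
`inl ({1} × (0, 1)) ∪ inr ({1} × (1/2, 3/2))`, and it has a tubular neighbourhood
`𝕊¹ × ℝ³ ↪ T_A` obtained from a smooth path from `1` to `A` in `GL(3, ℝ)`
(`nonempty_smoothMatrixPath_specialLinearGroup`), i.e. from a trivialisation of its normal bundle,
the mapping torus of `dA = A` on `T_1 T³ = ℝ³` (Cappell–Shaneson, *Some new four-manifolds*,
Ann. of Math. 104 (1976), §2; Gompf, Algebr. Geom. Topol. 10 (2010), §3). [cite: CappellShaneson1976, §2] -/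
theorem exists_mappingTorus_sectionCircleNbhd_witness (A : Matrix.SpecialLinearGroup (Fin 3) ℤ) :
    ∃ (T : Type) (_ : TopologicalSpace T) (_ : T2Space T) (_ : SecondCountableTopology T)
      (_ : CompactSpace T) (_ : ChartedSpace (𝔼 4) T) (_ : IsManifold (𝓡 4) ∞ T)
      (jA : ThreeTorus × ↥mappingTorusPieceOne → T) (jB : ThreeTorus × ↥mappingTorusPieceTwo → T),
      IsOpenGluingWith (ModelWithCorners.prod 𝓣 𝓘(ℝ, ℝ))
          (ModelWithCorners.prod 𝓣 𝓘(ℝ, ℝ)) (𝓡 4)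
          (mappingTorusRel ⇑(torusDiffeomorph A)) jA jB ∧
        ∃ c : 𝕊 1 → T, Manifold.IsSmoothEmbedding (𝓡 1) (𝓡 4) ∞ c ∧
          Set.range c = jA '' ({1} ×ˢ Set.univ) ∪ jB '' ({1} ×ˢ Set.univ) ∧
          Nonempty (CircleNbhd (𝓡 4) c) := by
  obtain ⟨γ⟩ := nonempty_smoothMatrixPath_specialLinearGroup A
  exact ⟨CSTorus A, inferInstance, inferInstance, inferInstance, inferInstance, inferInstance,
    inferInstance, (csGlueData A).inl, (csGlueData A).inr, isOpenGluingWith_mappingTorusGlued _ _,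
    sectionCircle A γ, isSmoothEmbedding_sectionCircle A γ, range_sectionCircle A γ,
    ⟨sectionCircleNbhd A γ⟩⟩

end Literature.Topology.FourManifolds
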